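import Literature.AnabelianGeometry.EtaleTheta.Discharge.Sec2HasMuLIffTrivialAction
import Literature.AnabelianGeometry.EtaleTheta.Discharge.Sec2HasMuLModelChiCuspIff
import Literature.AnabelianGeometry.EtaleTheta.Discharge.Sec2Cor29ModelKrullNormalizer
import Literature.AnabelianGeometry.EtaleTheta.SettingModelChiCuspCyclotomes
import HarnessLib

/-!
# [EtTh] Rmk. 2.6.1's hypothesis at the models, by the ABSTRACT route: `χ′` (cyclotome datum present — `HasMuL ⟺ μ_l ⊆ ℚ_p`,
# an independent route) and `κ′` (NO cyclotome datum off `l ∣ p − 1` — `HasMuL` holds while `μ_l ⊄ ℚ_p`: the cyclotome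
# hypothesis of the abstract equivalence is NOT removable) (proof-only)

S. Mochizuki, *The étale theta function and its Frobenioid-theoretic manifestations*, Publ. RIMS **45** (2009) [EtTh], §2:
Rmk. 2.6.1 p. 40, Def. 2.13 p. 46 («the natural isomorphism `μ_N ≅ (l·Δ_Θ) ⊗ (ℤ/Nℤ)`») [cite: MochizukiEtTh2009, Rmk 2.6.1 p.40].
Cell abc-iut, layer L2, seat abc-iut-L2-t10 (gen 7); companion of p470982 (`Sec2HasMuLIffTrivialAction`: at every `MuTwoSetting` of
[EtTh] origin with `μ : CyclotomeMod 1 l`, `T.HasMuL ↔ μ_l(ℚ̄_p) ⊆ K`). PROOF-ONLY (0 definitions).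

* `SettingModel.inversionModelχ'_nonempty_cyclotomeMod` — the cusped χ-model's cyclotome identifications (`SettingModelChiCuspCyclotomes`,
  `modelχ'_nonempty_cyclotomeMod`, from `Δ_Θ(curveχ) ≅ Ẑ(χ)`) read on the `MuTwoSetting` of the R312 capstone (`rfl`);
* **`SettingModel.hasMuL_coverOfRecordχ'_iff_coe_muN_mem_K`** — `T.HasMuL ↔ μ_l(ℚ̄_p) ⊆ ℚ_p` for THE R312 cover of record at `χ′`, from
  the ABSTRACT equivalence (p470982); with K12's census `μ_l ⊆ ℚ_p ⟺ l ∣ p − 1` (odd `l`) this is an independent route to p467907's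
  `hasMuL_coverOfRecordχ'_iff` (there: the level-`l` Heisenberg character) — the two kernel-checked routes agree;
* **`SettingModel.exists_hasMuL_and_not_muL_subset_K_inversionModelκ'`** — at the UNTWISTED `κ′` (odd `l ∤ p − 1`): a setting-born cover
  with `HasMuL` (K10 v2, `(Π^tp_X)^Θ` centralises `Δ_Θ`) although `μ_l(ℚ̄_p) ⊄ K = ℚ_p` (K12) — so in the abstract theorem the cyclotome
  datum `μ : CyclotomeMod 1 l` CANNOT be dropped (and indeed `CyclotomeMod 1 l = ∅` there, K11): the equivalence «`HasMuL` ⟺ `μ_l ⊆ K`»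
  is a statement about settings whose `Δ_Θ` IS `Ẑ(1)` mod `l`, as in print;
* **`CLevelData.temperedCoverDataOfHuuOfSection_rmk261_of_coe_muN_mem_K`** — [EtTh] Rmk. 2.6.1 AS PRINTED (hypothesis «`K ⊇ μ_l`»,
  conclusion the four `Aut_K` groups) for the R312 constructor at every `MuTwoSetting` of [EtTh] origin with a cyclotome datum.

HONEST LIMITS: semi-synthetic models = consistency / tightness evidence for the typed interface only; nothing of [EtTh] asserted; no side
taken on [IUTchIII] Cor. 3.12; typed ≠ proved.
-/

noncomputable section

namespace Literature.AnabelianGeometry.EtaleTheta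

namespace SettingModel

open Literature.AnabelianGeometry.SemiGraphs ThetaCovers ThetaSetting

variable (p : ℕ) [Fact p.Prime]

/-! ### `χ′`: the cyclotome datum exists, and the abstract route re-derives `HasMuL ⟺ l ∣ p − 1` -/

/-- The same read on the `MuTwoSetting` of the R312 capstone (`(inversionModelχ′ p).toThetaSetting = modelχ′ p`, `rfl`).
[cite: MochizukiEtTh2009, Def 2.13 p.46] -/
theorem inversionModelχ'_nonempty_cyclotomeMod {l : ℕ} (hl : 0 < l) (N : ℕ+) :
    Nonempty ((MuTwoSetting.inversionModelχ' p).toThetaSetting.CyclotomeMod l N) :=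
  modelχ'_nonempty_cyclotomeMod p hl N

/-- **THE R312 cover of record at `χ′`, BY THE ABSTRACT ROUTE: `T.HasMuL ↔ μ_l(ℚ̄_p) ⊆ K (= ℚ_p)`** — p470982's
`temperedCoverDataOfHuuOfSection_hasMuL_iff_coe_muN_mem_K` instantiated with the cusped χ-model's cyclotome datum; together with K12's
`hμK_modelχ'_iff_of_odd` (`μ_l ⊆ ℚ_p ⟺ l ∣ p − 1`, odd `l`) this re-derives p467907's `hasMuL_coverOfRecordχ'_iff` by an independent route
(not restated here). [cite: MochizukiEtTh2009, Rmk 2.6.1 p.40] -/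
theorem hasMuL_coverOfRecordχ'_iff_coe_muN_mem_K {E : (ThetaSetting.modelχ' p).EtaleThetaData} {l : ℕ+} (hodd : Odd (l : ℕ))
    (C : E.DoubleUnderline (l : ℕ)) (eX : (ThetaSetting.modelχ' p).OncePuncturedData)
    (hK : (MuTwoSetting.inversionModelχ' p).barKerTp l ≤ C.Huu) (hsH : ∀ σ, sectionχ' p σ ∈ C.Huu)
    (hι : C.IotaStable ((cLevelDataInvχ' p).conjX (epsPMInvχ p))) :
    ((cLevelDataInvχ' p).temperedCoverDataOfHuuOfSection (cLevelDataInvχ' p).toPiCHat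
      (cLevelDataInvχ' p).isProfiniteCompletion_toPiCHat (cLevelDataInvχ' p).toPiCHat_injective eX hodd (sectionχ' p)
      (aug_sectionχ' p) (toZ_sectionχ' p) (inv_ell_piCData_inversionModelχ' p l eX)
      ((cLevelDataInvχ' p).map_inclX_GtpXu_normal l (kerToZIsCompactlyGenerated_modelχ' p))
      ((cLevelDataInvχ' p).map_inclX_GtpY_normal (kerToZIsCompactlyGenerated_modelχ' p)) C hK hsH
      (epsPMInvχ_not_mem_range p) hι).HasMuL ↔
      ∀ ζ : MuN p l, (((ζ : (PadicAlgCl p)ˣ)) : PadicAlgCl p) ∈ (MuTwoSetting.inversionModelχ' p).K := by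
  obtain ⟨μ⟩ := inversionModelχ'_nonempty_cyclotomeMod p Nat.one_pos l
  exact (cLevelDataInvχ' p).temperedCoverDataOfHuuOfSection_hasMuL_iff_coe_muN_mem_K _ _ _ eX hodd _ _ _ _ _ _ C hK hsH _ hι μ

/-! ### `κ′`: `HasMuL` WITHOUT `μ_l ⊆ K` — the cyclotome hypothesis of the abstract equivalence is not removable -/

/-- **At the untwisted Krull model `κ′`, for odd `p` and odd `l ∤ p − 1`: a setting-born `TemperedCoverData` on THE `Π^tp_C` of
`inversionModelκ′` satisfies `HasMuL` (K10 v2: `(Π^tp_X)^Θ` CENTRALISES `Δ_Θ`), yet `μ_l(ℚ̄_p) ⊄ K = ℚ_p` (K12)** — so «`HasMuL` ⟺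
`μ_l ⊆ K`» FAILS without a cyclotome datum (none exists there: K11 `isEmpty_cyclotomeMod_one_modelκ'_of_odd_not_dvd`); the hypothesis
`μ : CyclotomeMod 1 l` of p470982's equivalence is essential. [cite: MochizukiEtTh2009, Rmk 2.6.1 p.40] -/
theorem exists_hasMuL_and_not_muL_subset_K_inversionModelκ' {l : ℕ+} (hodd : Odd (l : ℕ)) (hl : ¬ (l : ℕ) ∣ p - 1) :
    ∃ T : TemperedCoverData.{0} l,
      T.toCoverDataAx = ((cLevelDataInvκ' p).piCDataOf (toHatCκ p) (isProfiniteCompletion_toHatCκ p)).coverDataAx l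
        (nonempty_oncePuncturedData_modelκ' p).some (x := ()) trivial hodd
        (hIx_piCDataOf_toHatCκ p l hodd.pos (nonempty_oncePuncturedData_modelκ' p).some ())
        (inv_ell_piCDataOf_toHatCκ p l (nonempty_oncePuncturedData_modelκ' p).some)
        (inv_theta_piCDataOf_toHatCκ p l (nonempty_oncePuncturedData_modelκ' p).some) ∧
      T.HasMuL ∧ ¬ ∀ ζ : MuN p l, (((ζ : (PadicAlgCl p)ˣ)) : PadicAlgCl p) ∈ (MuTwoSetting.inversionModelκ' p).K := by
  obtain ⟨T, hT, hMuL, -⟩ := exists_temperedCoverData_hasMuL_cor29_inversionModelκ' p hodd (nonempty_oncePuncturedData_modelκ' p).some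
  exact ⟨T, hT, hMuL, fun h => hl ((hμK_modelκ'_iff_of_odd p l hodd).mp h)⟩

/-- The same, stated as the failure of the abstract equivalence's conclusion shape at `κ′`: there `HasMuL` does NOT imply `μ_l ⊆ K`.
[cite: MochizukiEtTh2009, Rmk 2.6.1 p.40] -/
theorem not_hasMuL_imp_muL_subset_K_inversionModelκ' {l : ℕ+} (hodd : Odd (l : ℕ)) (hl : ¬ (l : ℕ) ∣ p - 1) :
    ¬ ∀ T : TemperedCoverData.{0} l,
        T.toCoverDataAx = ((cLevelDataInvκ' p).piCDataOf (toHatCκ p) (isProfiniteCompletion_toHatCκ p)).coverDataAx l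
          (nonempty_oncePuncturedData_modelκ' p).some (x := ()) trivial hodd
          (hIx_piCDataOf_toHatCκ p l hodd.pos (nonempty_oncePuncturedData_modelκ' p).some ())
          (inv_ell_piCDataOf_toHatCκ p l (nonempty_oncePuncturedData_modelκ' p).some)
          (inv_theta_piCDataOf_toHatCκ p l (nonempty_oncePuncturedData_modelκ' p).some) →
        T.HasMuL → ∀ ζ : MuN p l, (((ζ : (PadicAlgCl p)ˣ)) : PadicAlgCl p) ∈ (MuTwoSetting.inversionModelκ' p).K := by
  intro h
  obtain ⟨T, hT, hMuL, hnot⟩ := exists_hasMuL_and_not_muL_subset_K_inversionModelκ' p hodd hl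
  exact hnot (h T hT hMuL)


/-! ### [EtTh] Rmk. 2.6.1 under PRINT'S hypothesis, at every setting of [EtTh] origin with a cyclotome datum -/

end SettingModel

namespace MuTwoSetting.CLevelData

open Literature.AnabelianGeometry.SemiGraphs ThetaCovers

variable {p : ℕ} [Fact p.Prime] {M : MuTwoSetting p}
variable {PC : Type} [Group PC] [TopologicalSpace PC] [IsTopologicalGroup PC] [T2Space PC]

/-- **[EtTh] Rmk. 2.6.1 AS PRINTED — hypothesis «`K` contains a primitive `l`-th root of unity», conclusion the four `Aut_K` groups** —
for abc-iut-L2-d3's R312 constructor of record at ANY `MuTwoSetting` of [EtTh] origin carrying a cyclotome datum `μ : CyclotomeMod 1 l`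
(odd `l`): `μ_l(ℚ̄_p) ⊆ K ⟹ Aut_K(X̲̲) ≅ ℤ/l × ℤ/2, Aut_K(X̲) ≅ D_l, Aut_K(C̲̲) ≅ ℤ/l, Aut_K(C̲) = 1` (p466422's `…_rmk261` fed through
p470982's `…_hasMuL_iff_coe_muN_mem_K`). [cite: MochizukiEtTh2009, Rmk 2.6.1 p.40] -/
theorem temperedCoverDataOfHuuOfSection_rmk261_of_coe_muN_mem_K (e : M.CLevelData) (ιC : M.GtpC →ₜ* PC)
    (hιC : IsProfiniteCompletion ιC) (hinj : Function.Injective ιC) (op : M.toThetaSetting.OncePuncturedData) {l : ℕ+}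
    (hodd : Odd (l : ℕ)) (s : ↥M.GK →* M.PiTemp) (hsa : ∀ σ, M.aug (s σ) = (σ : GQp p)) (hsZ : ∀ σ, M.toZ (s σ) = 1)
    (hιell : ∀ c ∈ (e.piCDataOf ιC hιC).augGK.ker, c ∉ (e.piCDataOf ιC hιC).PiX →
      ∀ d ∈ (e.piCDataOf ιC hιC).PiX ⊓ (e.piCDataOf ιC hιC).augGK.ker,
        c * d * c⁻¹ * d ∈ (e.piCDataOf ιC hιC).barTheta l)
    (hN : ((M.GtpXu l).map M.inclX).Normal) (hY : (M.GtpY.map M.inclX).Normal)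
    {E : M.toThetaSetting.EtaleThetaData} (C : E.DoubleUnderline l) (hK : M.barKerTp l ≤ C.Huu)
    (hsH : ∀ σ, s σ ∈ C.Huu) {g : M.GtpC} (hgX : g ∉ M.inclX.range) (hι : C.IotaStable (e.conjX g))
    (μ : M.toThetaSetting.CyclotomeMod 1 l) (hμK : ∀ ζ : MuN p l, ((ζ : (PadicAlgCl p)ˣ) : PadicAlgCl p) ∈ M.K) :
    Nonempty ((e.temperedCoverDataOfHuuOfSection ιC hιC hinj op hodd s hsa hsZ hιell hN hY C hK hsH hgX hι).autK
        ((e.temperedCoverDataOfHuuOfSection ιC hιC hinj op hodd s hsa hsZ hιell hN hY C hK hsH hgX hι).tp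
          (e.temperedCoverDataOfHuuOfSection ιC hιC hinj op hodd s hsa hsZ hιell hN hY C hK hsH hgX hι).PiXuu) ≃*
        Multiplicative (ZMod l) × Multiplicative (ZMod 2)) ∧
      Nonempty ((e.temperedCoverDataOfHuuOfSection ιC hιC hinj op hodd s hsa hsZ hιell hN hY C hK hsH hgX hι).autK
        ((e.temperedCoverDataOfHuuOfSection ιC hιC hinj op hodd s hsa hsZ hιell hN hY C hK hsH hgX hι).tp
          (e.temperedCoverDataOfHuuOfSection ιC hιC hinj op hodd s hsa hsZ hιell hN hY C hK hsH hgX hι).PiXu) ≃*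
        DihedralGroup l) ∧
      Nonempty ((e.temperedCoverDataOfHuuOfSection ιC hιC hinj op hodd s hsa hsZ hιell hN hY C hK hsH hgX hι).autK
        ((e.temperedCoverDataOfHuuOfSection ιC hιC hinj op hodd s hsa hsZ hιell hN hY C hK hsH hgX hι).tp
          (e.temperedCoverDataOfHuuOfSection ιC hιC hinj op hodd s hsa hsZ hιell hN hY C hK hsH hgX hι).PiCuu) ≃*
        Multiplicative (ZMod l)) ∧
      Subsingleton ((e.temperedCoverDataOfHuuOfSection ιC hιC hinj op hodd s hsa hsZ hιell hN hY C hK hsH hgX hι).autK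
        ((e.temperedCoverDataOfHuuOfSection ιC hιC hinj op hodd s hsa hsZ hιell hN hY C hK hsH hgX hι).tp
          (e.temperedCoverDataOfHuuOfSection ιC hιC hinj op hodd s hsa hsZ hιell hN hY C hK hsH hgX hι).PiCu)) :=
  e.temperedCoverDataOfHuuOfSection_rmk261 ιC hιC hinj op hodd s hsa hsZ hιell hN hY C hK hsH hgX hι
    ((e.temperedCoverDataOfHuuOfSection_hasMuL_iff_coe_muN_mem_K ιC hιC hinj op hodd s hsa hsZ hιell hN hY C hK hsH hgX hι
      μ).mpr hμK)

end MuTwoSetting.CLevelData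

end Literature.AnabelianGeometry.EtaleTheta

end
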